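import Mathlib
import HarnessLib
import Summits.NavierStokesRegularity.NavierStokesRegularity.Theorems.PoloidalWindowDoorLrcModEntireJetCertPsatzElimHStage

/-!
# Jet-certificate checker — STAGED replay for the PLAIN variant (`…JetCertPsatzElim.etreeCheck`, rational-tilt cells without pins)

Cell `ns-wall-extremal`, arm C (PREREG-WALL-1 §C, C1a rational-tilt cells), seat ns-wall-eng-6 g2 (Lean hands, crc-p1's pipeline), 2026-08-28.
`--supports stmt-NavierStokesRegularity-19708` (instrument).  Generic; no Navier–Stokes content.  Sibling of `…JetCertPsatzElimHStage` (all-tilt cells,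
content removal): the SAME staging for the plain checker `etreeCheck` / `kills_of_killCheck` — a big rational-tilt cell (e.g. T1′(4,3) at γ = 2: 149 laws,
105 476 terms; ≈ 34 s in the Python mirror ⇒ ≈ 7 min natively, at the gate's 600 s budget) is cut into stages whose slices each replay within budget.

* `runE` (replay a list of `HStep`s: the `elim`/`force` branches of `etreeCheck`, verbatim; gauge letters and sign conditions empty), `pointDatum_runE`;
* `stageCheckE` (+ **`pointDatum_of_stageCheckE`**), reusing `polyListEq` of `…ElimHStage`;
* **`kills_of_stagesE`**: a chain `PointDatum (hyps, pins ++ [Σ X_j²]) → PointDatum (h_K, p_K)` + `etreeCheck n h_K p_K [] [] t` ⇒ `Kills n hyps pins [] [] J`;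
* self-test (`decide +kernel`): the toy transcript of `…JetCertPsatzElim` cut into two stages.

WHAT THIS IS NOT: not a claim about Navier–Stokes, not a certificate. [folklore]
-/

noncomputable section

-- the summit and its single sub-problem share the name (CONVENTIONS §1), as in every Theorems file
set_option linter.dupNamespace false

namespace Summit.NavierStokesRegularity.NavierStokesRegularity.Theorems.PoloidalWindowDoorLrcModEntireJetCertPsatzElimStage

open _root_.Topology _root_.Filter Set
open Literature.Analysis.ValidatedNumerics Literature.Analysis.ValidatedNumerics.QMvPoly
open Literature.Analysis.Calculus.MvPoly
open Summit.NavierStokesRegularity.NavierStokesRegularity.Theorems.PoloidalWindowDoorLrcModEntireJetCertDefs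
open Summit.NavierStokesRegularity.NavierStokesRegularity.Theorems.PoloidalWindowDoorLrcModEntireJetCertTree
open Summit.NavierStokesRegularity.NavierStokesRegularity.Theorems.PoloidalWindowDoorLrcModEntireJetCertFast2
open Summit.NavierStokesRegularity.NavierStokesRegularity.Theorems.PoloidalWindowDoorLrcModEntireJetCertGauge
open Summit.NavierStokesRegularity.NavierStokesRegularity.Theorems.PoloidalWindowDoorLrcModEntireJetCertPsatz
open Summit.NavierStokesRegularity.NavierStokesRegularity.Theorems.PoloidalWindowDoorLrcModEntireJetCertPsatzSubst
open Summit.NavierStokesRegularity.NavierStokesRegularity.Theorems.PoloidalWindowDoorLrcModEntireJetCertPsatzElim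
open Summit.NavierStokesRegularity.NavierStokesRegularity.Theorems.PoloidalWindowDoorLrcModEntireJetCertPsatzElimN
open Summit.NavierStokesRegularity.NavierStokesRegularity.Theorems.PoloidalWindowDoorLrcModEntireJetCertPsatzElimG
open Summit.NavierStokesRegularity.NavierStokesRegularity.Theorems.PoloidalWindowDoorLrcModEntireJetCertPsatzElimH
open Summit.NavierStokesRegularity.NavierStokesRegularity.Theorems.PoloidalWindowDoorLrcModEntireJetCertPsatzElimHStage

variable {n : ℕ}

/-- **STAGED REPLAY (plain checker)**: run a list of steps from the state `(hyps, pins)` with exactly the side conditions and state updates of the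
`elim` / `force` branches of `etreeCheck` (gauge letters and sign conditions empty); `none` as soon as a side condition fails. [folklore] -/
def runE (n : ℕ) : List HStep → List QMvPoly → List QMvPoly → Option (List QMvPoly × List QMvPoly)
  | [], hyps, pins => some (hyps, pins)
  | (.elim k i κ pe) :: rest, hyps, pins =>
      let L := hyps.getD k []
      let c := coeffIn i L
      let num := QMvPoly.smul (-1) (restIn i L)
      if decide (i < n) && decide (κ ≠ 0) && decide (degIn i L ≤ 1) && polyEq c (QMvPoly.smul κ (pinProduct pins pe)) then
        runE n rest (hyps.map (substLaw i num c)) (pins.map (substLaw i num c))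
      else none
  | (.force k j κ pe e) :: rest, hyps, pins =>
      if decide (j < n) && decide (κ ≠ 0) && decide (1 ≤ e) &&
          polyEq (hyps.getD k []) (QMvPoly.smul κ (QMvPoly.mul (pinProduct pins pe) (powQ (QMvPoly.var n j) e))) then
        runE n rest (hyps ++ [QMvPoly.var n j]) pins
      else none

/-- **SOUNDNESS OF THE STAGED REPLAY (plain checker)**: a real point of the input system (laws `= 0`, pins `≠ 0`) is a real point of the output
system — the SAME point. [folklore] -/
theorem pointDatum_runE : ∀ (steps : List HStep) {hyps pins h' p' : List QMvPoly},
    runE n steps hyps pins = some (h', p') → PointDatum n hyps pins [] [] → PointDatum n h' p' [] [] := by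
  intro steps
  induction steps with
  | nil =>
    intro hyps pins h' p' h hd
    simp only [runE, Option.some.injEq, Prod.mk.injEq] at h
    obtain ⟨rfl, rfl⟩ := h
    exact hd
  | cons s rest ih =>
    intro hyps pins h' p' h hd
    cases s with
    | elim k i κ pe =>
      simp only [runE] at h
      split_ifs at h with hc
      simp only [Bool.and_eq_true, decide_eq_true_eq] at hc
      obtain ⟨⟨⟨hi, hκ⟩, hdeg⟩, hcf⟩ := hc
      obtain ⟨z, hh, hp, hz, hq⟩ := hd
      set L := hyps.getD k [] with hL
      set c := coeffIn i L with hc_def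
      set num := QMvPoly.smul (-1) (restIn i L) with hnum
      have hcz : ev n c z ≠ 0 := by
        rw [ev_eq_of_polyEq hcf z, ev_smul]
        exact mul_ne_zero (by exact_mod_cast hκ) (ev_pinProduct_ne_zero z pins pe hp)
      have hLz : ev n L z = 0 := ev_getD_eq_zero hh k
      have hlin := ev_linear_split z ⟨i, hi⟩ L hdeg
      have hzi : ev n c z * z ⟨i, hi⟩ = ev n num z := by
        rw [hnum, ev_smul]; push_cast
        have : z ⟨i, hi⟩ * ev n c z + ev n (restIn i L) z = 0 := by rw [← hLz, hlin]
        linarith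
      refine ih h ⟨z, ?_, ?_, hz, hq⟩
      · intro L' hL'
        obtain ⟨P, hP, rfl⟩ := List.mem_map.1 hL'
        exact ev_substLaw_eq_zero z ⟨i, hi⟩ num c hzi (hh P hP)
      · intro π' hπ'
        obtain ⟨P, hP, rfl⟩ := List.mem_map.1 hπ'
        exact ev_substLaw_ne_zero z ⟨i, hi⟩ num c hzi hcz (hp P hP)
    | force k j κ pe e =>
      simp only [runE] at h
      split_ifs at h with hc
      simp only [Bool.and_eq_true, decide_eq_true_eq] at hc
      obtain ⟨⟨⟨hj, hκ⟩, he⟩, hform⟩ := hc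
      obtain ⟨z, hh, hp, hz, hq⟩ := hd
      have hLz : ev n (hyps.getD k []) z = 0 := ev_getD_eq_zero hh k
      rw [ev_eq_of_polyEq hform z, ev_smul, ev_mul, ev_powQ, ev_var z ⟨j, hj⟩] at hLz
      have hzj : z ⟨j, hj⟩ = 0 := by
        have h1 : (κ : ℝ) ≠ 0 := by exact_mod_cast hκ
        have h2 := ev_pinProduct_ne_zero z pins pe hp
        have h3 : z ⟨j, hj⟩ ^ e = 0 := by
          rcases mul_eq_zero.1 hLz with h | h
          · exact absurd h h1
          · rcases mul_eq_zero.1 h with h' | h'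
            · exact absurd h' h2
            · exact h'
        exact pow_eq_zero_iff (by omega) |>.1 h3
      refine ih h ⟨z, ?_, hp, hz, hq⟩
      intro L hL
      rcases List.mem_append.1 hL with hL' | hL'
      · exact hh L hL'
      · rw [List.mem_singleton.1 hL', ev_var z ⟨j, hj⟩]; exact hzj

/-- **STAGE CHECK (plain checker)** (Boolean): the steps replay from `(hyps, pins)` and land on `(h₁, p₁)` up to `polyEq`. [folklore] -/
def stageCheckE (n : ℕ) (hyps pins : List QMvPoly) (steps : List HStep) (h₁ p₁ : List QMvPoly) : Bool :=
  match runE n steps hyps pins with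
  | none => false
  | some s => polyListEq s.1 h₁ && polyListEq s.2 p₁

/-- **SOUNDNESS OF A STAGE (plain checker)**: a real point of the stage's input system is a real point of its declared output system. [folklore] -/
theorem pointDatum_of_stageCheckE {hyps pins h₁ p₁ : List QMvPoly} {steps : List HStep}
    (h : stageCheckE n hyps pins steps h₁ p₁ = true) (hd : PointDatum n hyps pins [] []) : PointDatum n h₁ p₁ [] [] := by
  cases hr : runE n steps hyps pins with
  | none => simp [stageCheckE, hr] at h
  | some s =>
    obtain ⟨s1, s2⟩ := s
    simp only [stageCheckE, hr, Bool.and_eq_true] at h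
    exact pointDatum_of_polyListEq h.1 h.2 (pointDatum_runE steps hr hd)

/-- **ASSEMBLY OF A STAGED KILL (plain checker)**: if every real point of `(hyps, pins ++ [Σ_{j∈J} X_j²])` is carried by the stages to a real point of
`(h_K, p_K)`, and the final transcript slice refutes `(h_K, p_K)` under `etreeCheck`, then every real solution is untwisted — the statement of
`kills_of_killCheck`, by the same argument. [folklore] -/
theorem kills_of_stagesE {hyps pins hK pK : List QMvPoly} {J : List ℕ} {t : ETree}
    (hchain : PointDatum n hyps (pins ++ [sumSq n J]) [] [] → PointDatum n hK pK [] [])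
    (ht : etreeCheck n hK pK [] [] t = true) : Kills n hyps pins [] [] J := by
  intro z hh hp hz hq j hjJ hj
  by_contra hne
  refine not_pointDatum_of_etreeCheck t ht (hchain ⟨z, hh, ?_, hz, hq⟩)
  intro π hπ
  rcases List.mem_append.1 hπ with h' | h'
  · exact hp π h'
  · rw [List.mem_singleton.1 h', ev_sumSq]
    have hnn : ∀ x ∈ J.map (fun j => ev n (QMvPoly.var n j) z * ev n (QMvPoly.var n j) z), (0 : ℝ) ≤ x := by
      intro x hx
      obtain ⟨j', -, rfl⟩ := List.mem_map.1 hx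
      exact mul_self_nonneg _
    have hmem : ev n (QMvPoly.var n j) z * ev n (QMvPoly.var n j) z ∈
        J.map (fun j => ev n (QMvPoly.var n j) z * ev n (QMvPoly.var n j) z) := List.mem_map.2 ⟨j, hjJ, rfl⟩
    have hle := List.single_le_sum hnn _ hmem
    have hpos : 0 < ev n (QMvPoly.var n j) z * ev n (QMvPoly.var n j) z := by
      rw [ev_var z ⟨j, hj⟩]; exact mul_self_pos.2 hne
    exact ne_of_gt (lt_of_lt_of_le hpos hle)

/-! ### Self-test (`decide +kernel`): the toy transcript of `…JetCertPsatzElim`, cut after its first step -/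

/-- Stage 1 of the toy transcript: `elim 0 0 2 []` (so `X₀ = 1/2`) carries the toy system to the declared state. [folklore] -/
theorem example_stage1 :
    stageCheckE 3 [[([1, 0, 0], (2 : ℚ)), ([0, 0, 0], (-1 : ℚ))], [([1, 2, 0], (1 : ℚ))], [([0, 0, 1], (2 : ℚ)), ([1, 0, 1], (-2 : ℚ)), ([0, 0, 1], (-1 : ℚ))]]
      [sumSq 3 [1]] [.elim 0 0 2 []]
      [[], [([0, 2, 0], (1 : ℚ))], []] [[([0, 2, 0], (1 : ℚ))]] = true := by
  decide +kernel

/-- Stage 2 (final slice) of the toy transcript replays on the declared state. [folklore] -/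
theorem example_stage2 :
    etreeCheck 3 [[], [([0, 2, 0], (1 : ℚ))], []] [[([0, 2, 0], (1 : ℚ))]] [] []
      (.force 1 1 1 [] 2 (.elim 3 1 1 [] (.leaf { steps := [], comb := [], e := [1], sos0 := [], sosG := [] }))) = true := by
  decide +kernel

/-- The toy kill, assembled from the two stages — the same statement `example_kills` of `…JetCertPsatzElim` certifies in one go. [folklore] -/
theorem example_kills_staged :
    Kills 3 [[([1, 0, 0], (2 : ℚ)), ([0, 0, 0], (-1 : ℚ))], [([1, 2, 0], (1 : ℚ))], [([0, 0, 1], (2 : ℚ)), ([1, 0, 1], (-2 : ℚ)), ([0, 0, 1], (-1 : ℚ))]]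
      [] [] [] [1] :=
  kills_of_stagesE (fun hd => pointDatum_of_stageCheckE example_stage1 hd) example_stage2

end Summit.NavierStokesRegularity.NavierStokesRegularity.Theorems.PoloidalWindowDoorLrcModEntireJetCertPsatzElimStage

end
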